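import Literature.AlgebraicGeometry.HodgeTheory.ConjugationChartExistence
import Literature.AlgebraicGeometry.HodgeTheory.RationallyNormalisedDeRhamFamily
import Summits.HodgeConjecture.HodgeConjecture.Theorems.BoundaryReadoutHCOverNumberFieldsSplit
import HarnessLib

/-!
# Crux `HCOverNumberFields` (stmt-HodgeConjecture-1070) — the infrastructure stub `stub_conjugate_exists`
# closed modulo four printed theorems

The ACTIVE skeleton of the crux (`Cruxes/HCOverNumberFields/Lines/derham_betti.lean`, also `Lines/birth.lean`
and `Cruxes/BoundaryAbsoluteness/Lines/birth.lean` of stmt-HodgeConjecture-15913) registers the infrastructure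
stub

  `stub_conjugate_exists : ∀ ⦃n X⦄, IsSmoothProjective n X → ∀ σ k c, ∃ c', IsConjugateClass σ X k c c'`

("conjugates exist": Jouanolou's affine torsor + GAGA + de Rham + Grothendieck's comparison — a theorem in
print, size L/XL as tree infrastructure). This file proves that signature VERBATIM from the four named facts of
`Literature.AlgebraicGeometry.HodgeTheory.ConjugationChartExistence` — (J) `jouanolou_cohomologyChart`,
(R) `exists_isRational_complexDeRhamIsoFamily`, (G) `grothendieck_comparison_realize_surjective`,
(C) `conj_realize_mem_cclosedSmoothForms` — whose assembly (analytic models of smooth affines, base change of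
smooth affines, the chart, the descent of the conjugate form's class along `(π^σ)^*`) is PROVED there
(`exists_isConjugateClass_of_facts`). Consequences recorded here, all CONDITIONAL (the item stays open — it
is the Hodge conjecture for varieties definable over number fields):

* `stub_conjugate_exists_of_facts` — the registered stub, modulo (J), (R), (G), (C);
* `hcOverNumberFields_of_facts_of_subs` — the strategist's split glue `hcOverNumberFields_of_subs`
  (`BoundaryReadoutHCOverNumberFieldsSplit`) with its first child discharged modulo the four facts: the crux
  follows from (J), (R), (G), (C) + "conjugates of Hodge classes on arithmetic varieties are twisted rational
  `(p,p)`" + "absolute Hodge classes on arithmetic varieties are algebraic";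
* `hcOverNumberFields_of_facts_deRhamBetti` — the active line's composition `HCOverNumberFields_of` with its
  stub 1 discharged modulo the four facts: the crux follows from (J), (R), (G), (C) + stub 2
  (`ℚ̄`-de Rham descent of Hodge classes) + stub 3 (Hodge de Rham–Betti classes are algebraic).

So the trust base of either line no longer contains an unnamed "XL infrastructure" item but four Literature
facts with locators, two of them (R), (C) of moderate size.
-/

-- Intentional: the problem-level namespace `Summit.<Summit>.<Problem>.Theorems` repeats `HodgeConjecture`.
set_option linter.dupNamespace false

noncomputable section

namespace Summit.HodgeConjecture.HodgeConjecture.Theorems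

open CategoryTheory
open Literature.AlgebraicGeometry.Motives Literature.AlgebraicGeometry.HodgeTheory

/-- **The registered stub `stub_conjugate_exists`, modulo the four printed inputs.** For `X` smooth projective
over `ℂ`, every `σ ∈ Aut ℂ`, degree `k` and class `c ∈ Hᵏ(X(ℂ); ℂ)` has a `σ`-conjugate on `X^σ`, granted
(J) Jouanolou's cohomology chart, (R) a natural rationally normalised de Rham family, (G) Grothendieck's
comparison on smooth affines and (C) closedness of conjugate realisations
(`exists_isConjugateClass_of_facts`). Signature verbatim the stub of `Lines/derham_betti.lean` / `Lines/birth.lean`.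
[cite: CharlesSchnell2014Notes, §11.2.2 (11.2.3)] [cite: Jouanolou1973, Lemme 1.5] [cite: Grothendieck1966, Thm. 1'] -/
theorem stub_conjugate_exists_of_facts (hJ : jouanolou_cohomologyChart)
    (hR : exists_isRational_complexDeRhamIsoFamily) (hG : grothendieck_comparison_realize_surjective)
    (hC : conj_realize_mem_cclosedSmoothForms) :
    ∀ ⦃n : ℕ⦄ ⦃X : SchemeOver ℂ⦄, IsSmoothProjective n X →
      ∀ (σ : ℂ ≃+* ℂ) (k : ℕ) (c : complexBetti X k), ∃ c', IsConjugateClass σ X k c c' :=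
  exists_isConjugateClass_of_facts hJ hR hG hC

/-- **The absolute-Hodge split of the crux with its infrastructure child discharged modulo the four facts.**
(J), (R), (G), (C) + (every conjugate of a rational `(p,p)` class on an arithmetic variety is a twisted rational
`(p,p)` class) + (absolute Hodge classes on arithmetic varieties are algebraic) ⟹ `HCOverNumberFields`
(`hcOverNumberFields_of_subs` fed `stub_conjugate_exists_of_facts`). CONDITIONAL.
[cite: CharlesSchnell2014Notes, Def. 11.2.3 and §11.2.5] [cite: Voisin2007HodgeLoci, Prop. 1.2] -/
theorem hcOverNumberFields_of_facts_of_subs (hJ : jouanolou_cohomologyChart)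
    (hR : exists_isRational_complexDeRhamIsoFamily) (hG : grothendieck_comparison_realize_surjective)
    (hC : conj_realize_mem_cclosedSmoothForms)
    (h₂ : ∀ ⦃n : ℕ⦄ ⦃X : SchemeOver ℂ⦄, IsSmoothProjective n X →
      (∃ (K : Type) (_ : Field K) (_ : NumberField K) (σ : K →+* ℂ) (X₀ : SchemeOver K),
        Nonempty (X ≅ (baseChangeHom σ).obj X₀)) →
      ∀ (p : ℕ) (c : complexBetti X (2 * p)), IsRationalClass c → IsOfHodgeType n X (2 * p) p p c →
        ∀ (σ : ℂ ≃+* ℂ) (c' : complexBetti (conjugateVariety σ X) (2 * p)),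
          IsConjugateClass σ X (2 * p) c c' →
            ∃ β : complexBetti (conjugateVariety σ X) (2 * p),
              IsRationalClass β ∧ IsOfHodgeType n (conjugateVariety σ X) (2 * p) p p β ∧
                c' = periodTwist σ p • β)
    (h₃ : ∀ ⦃n : ℕ⦄ ⦃X : SchemeOver ℂ⦄, IsSmoothProjective n X →
      (∃ (K : Type) (_ : Field K) (_ : NumberField K) (σ : K →+* ℂ) (X₀ : SchemeOver K),
        Nonempty (X ≅ (baseChangeHom σ).obj X₀)) →
      ∀ (p : ℕ) (c : complexBetti X (2 * p)), IsAbsoluteHodgeClass n X p c → c ∈ algebraicClasses X p) :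
    Summit.HodgeConjecture.HodgeConjecture.Theses.BoundaryReadout.HCOverNumberFields :=
  hcOverNumberFields_of_subs (stub_conjugate_exists_of_facts hJ hR hG hC) h₂ h₃

/-- **The active line `derham-betti` with its stub 1 discharged modulo the four facts.** (J), (R), (G), (C)
+ STUB 2 (Hodge classes on arithmetic varieties descend to `ℚ̄` in de Rham cohomology: a finite set `S` of
algebraic numbers such that every conjugate under `σ ∈ Aut(ℂ/σ₀(K)(S))` is a twisted rational `(p,p)` class)
+ STUB 3 (Hodge de Rham–Betti classes on arithmetic varieties are algebraic) ⟹ `HCOverNumberFields`: the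
anti-vacuity conjunct of `HodgeConjectureFor` is the tree theorem `nonempty_hodgeModel_holds`; for a rational
`(p,p)` class, STUB 2 supplies `S`, the stub-1 theorem the conjugates, STUB 3 concludes (the composition
`HCOverNumberFields_of` of `Cruxes/HCOverNumberFields/Lines/derham_betti.lean`, signatures verbatim). CONDITIONAL.
[cite: BostCharles2014, §2] [cite: CharlesSchnell2014Notes, §11.2.5] -/
theorem hcOverNumberFields_of_facts_deRhamBetti (hJ : jouanolou_cohomologyChart)
    (hR : exists_isRational_complexDeRhamIsoFamily) (hG : grothendieck_comparison_realize_surjective)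
    (hC : conj_realize_mem_cclosedSmoothForms)
    (h₂ : ∀ ⦃n : ℕ⦄ ⦃X : SchemeOver ℂ⦄, IsSmoothProjective n X →
      ∀ (K : Type) [Field K] [NumberField K] (σ₀ : K →+* ℂ) (X₀ : SchemeOver K),
        Nonempty (X ≅ (baseChangeHom σ₀).obj X₀) →
      ∀ (p : ℕ) (c : complexBetti X (2 * p)), IsRationalClass c → IsOfHodgeType n X (2 * p) p p c →
        ∃ S : Finset ℂ, (∀ s ∈ S, IsAlgebraic ℚ s) ∧
          ∀ σ : ℂ ≃+* ℂ, (∀ x : K, σ (σ₀ x) = σ₀ x) → (∀ s ∈ S, σ s = s) →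
            ∀ c' : complexBetti (conjugateVariety σ X) (2 * p), IsConjugateClass σ X (2 * p) c c' →
              ∃ β : complexBetti (conjugateVariety σ X) (2 * p),
                IsRationalClass β ∧ IsOfHodgeType n (conjugateVariety σ X) (2 * p) p p β ∧
                  c' = periodTwist σ p • β)
    (h₃ : ∀ ⦃n : ℕ⦄ ⦃X : SchemeOver ℂ⦄, IsSmoothProjective n X →
      ∀ (K : Type) [Field K] [NumberField K] (σ₀ : K →+* ℂ) (X₀ : SchemeOver K),
        Nonempty (X ≅ (baseChangeHom σ₀).obj X₀) →
      ∀ (p : ℕ) (c : complexBetti X (2 * p)), IsRationalClass c → IsOfHodgeType n X (2 * p) p p c →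
        (∃ S : Finset ℂ, (∀ s ∈ S, IsAlgebraic ℚ s) ∧
          ∀ σ : ℂ ≃+* ℂ, (∀ x : K, σ (σ₀ x) = σ₀ x) → (∀ s ∈ S, σ s = s) →
            (∃ c', IsConjugateClass σ X (2 * p) c c') ∧
            ∀ c' : complexBetti (conjugateVariety σ X) (2 * p), IsConjugateClass σ X (2 * p) c c' →
              ∃ β : complexBetti (conjugateVariety σ X) (2 * p),
                IsRationalClass β ∧ IsOfHodgeType n (conjugateVariety σ X) (2 * p) p p β ∧
                  c' = periodTwist σ p • β) →
        c ∈ algebraicClasses X p) :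
    Summit.HodgeConjecture.HodgeConjecture.Theses.BoundaryReadout.HCOverNumberFields := by
  rintro n X hX ⟨K, _, _, σ₀, X₀, hm⟩
  refine ⟨nonempty_hodgeModel_holds hX, fun p c hc hpp ↦ ?_⟩
  obtain ⟨S, hS, hσ⟩ := h₂ hX K σ₀ X₀ hm p c hc hpp
  exact h₃ hX K σ₀ X₀ hm p c hc hpp
    ⟨S, hS, fun σ hK hSσ ↦ ⟨stub_conjugate_exists_of_facts hJ hR hG hC hX σ (2 * p) c, hσ σ hK hSσ⟩⟩

/-- **The registered stub `stub_conjugate_exists`, modulo (J), (G), (C) only** — input (R) (a natural,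
rationally normalised de Rham family) is now the Literature theorem
`exists_isRational_complexDeRhamIsoFamily_holds` (`RationallyNormalisedDeRhamFamily`): conjugates exist
for every smooth projective `X/ℂ` granted Jouanolou's cohomology chart, Grothendieck's comparison on
smooth affines and the closedness of conjugate realisations. Signature verbatim the stub.
[cite: CharlesSchnell2014Notes, §11.2.2 (11.2.3)] [cite: Jouanolou1973, Lemme 1.5] [cite: Grothendieck1966, Thm. 1'] -/
theorem stub_conjugate_exists_of_JGC (hJ : jouanolou_cohomologyChart)
    (hG : grothendieck_comparison_realize_surjective) (hC : conj_realize_mem_cclosedSmoothForms) :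
    ∀ ⦃n : ℕ⦄ ⦃X : SchemeOver ℂ⦄, IsSmoothProjective n X →
      ∀ (σ : ℂ ≃+* ℂ) (k : ℕ) (c : complexBetti X k), ∃ c', IsConjugateClass σ X k c c' :=
  stub_conjugate_exists_of_facts hJ exists_isRational_complexDeRhamIsoFamily_holds hG hC

/-- **The active line `derham-betti` modulo (J), (G), (C) + its stubs 2 and 3** (input (R) discharged).
[cite: BostCharles2014, §2] [cite: CharlesSchnell2014Notes, §11.2.5] -/
theorem hcOverNumberFields_of_JGC_deRhamBetti (hJ : jouanolou_cohomologyChart)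
    (hG : grothendieck_comparison_realize_surjective) (hC : conj_realize_mem_cclosedSmoothForms)
    (h₂ : ∀ ⦃n : ℕ⦄ ⦃X : SchemeOver ℂ⦄, IsSmoothProjective n X →
      ∀ (K : Type) [Field K] [NumberField K] (σ₀ : K →+* ℂ) (X₀ : SchemeOver K),
        Nonempty (X ≅ (baseChangeHom σ₀).obj X₀) →
      ∀ (p : ℕ) (c : complexBetti X (2 * p)), IsRationalClass c → IsOfHodgeType n X (2 * p) p p c →
        ∃ S : Finset ℂ, (∀ s ∈ S, IsAlgebraic ℚ s) ∧
          ∀ σ : ℂ ≃+* ℂ, (∀ x : K, σ (σ₀ x) = σ₀ x) → (∀ s ∈ S, σ s = s) →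
            ∀ c' : complexBetti (conjugateVariety σ X) (2 * p), IsConjugateClass σ X (2 * p) c c' →
              ∃ β : complexBetti (conjugateVariety σ X) (2 * p),
                IsRationalClass β ∧ IsOfHodgeType n (conjugateVariety σ X) (2 * p) p p β ∧
                  c' = periodTwist σ p • β)
    (h₃ : ∀ ⦃n : ℕ⦄ ⦃X : SchemeOver ℂ⦄, IsSmoothProjective n X →
      ∀ (K : Type) [Field K] [NumberField K] (σ₀ : K →+* ℂ) (X₀ : SchemeOver K),
        Nonempty (X ≅ (baseChangeHom σ₀).obj X₀) →
      ∀ (p : ℕ) (c : complexBetti X (2 * p)), IsRationalClass c → IsOfHodgeType n X (2 * p) p p c →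
        (∃ S : Finset ℂ, (∀ s ∈ S, IsAlgebraic ℚ s) ∧
          ∀ σ : ℂ ≃+* ℂ, (∀ x : K, σ (σ₀ x) = σ₀ x) → (∀ s ∈ S, σ s = s) →
            (∃ c', IsConjugateClass σ X (2 * p) c c') ∧
            ∀ c' : complexBetti (conjugateVariety σ X) (2 * p), IsConjugateClass σ X (2 * p) c c' →
              ∃ β : complexBetti (conjugateVariety σ X) (2 * p),
                IsRationalClass β ∧ IsOfHodgeType n (conjugateVariety σ X) (2 * p) p p β ∧
                  c' = periodTwist σ p • β) →
        c ∈ algebraicClasses X p) :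
    Summit.HodgeConjecture.HodgeConjecture.Theses.BoundaryReadout.HCOverNumberFields :=
  hcOverNumberFields_of_facts_deRhamBetti hJ exists_isRational_complexDeRhamIsoFamily_holds hG hC h₂ h₃

end Summit.HodgeConjecture.HodgeConjecture.Theorems

end
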